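import Summits.ResolutionOfSingularities.ResolutionOfSingularities.Theorems.DecompositionDescentLU7
import Literature.AlgebraicGeometry.Resolution.DecompositionLayerStrictParameters
import HarnessLib

/-!
# MonomialBlowupLU — DECOMPOSITION DESCENT, LAYER 3: a MONOMIAL BLOW-UP UPSTAIRS (the OUTPUT of
[CossartPiltant2008, Prop. 8.1] in a finite Hensel layer) COMES DOWN — the cell `MonomialBlowupAbove k O`, the
hypothesis-free law `MonomialBlowupAbove k O → QuasiFiniteLUAbove k O → RelLocalUniformization k K O`, and the
located residual `R31` (ROOT/RESIDUAL cell `decomp-res`, lens 1, g30; Door B «MonomialBlowup» of NEXT-g30 / critic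
rows 207, 223, 223c)

THESIS.  [CoP1] = Cossart–Piltant, *Resolution of singularities of threefolds in positive characteristic I*,
J. Algebra 320 (2008), §9 proves that local uniformization DESCENDS along a finite Hensel layer `K′ | K` inside the
decomposition field in three layers; the tree holds layer 1 (étale descent of regularity,
`relLU_of_decompositionFieldLUAbove`, g27) and layer 2 (ZMT / quasi-finiteness,
`decompositionFieldLUAbove_of_quasiFiniteLUAbove`, g27 — composite `relLU_of_quasiFiniteLUAbove`,
`Theorems/DecompositionDescentLU7`).  THIS NODE TYPES AND PROVES LAYER 3 in the summit frame, in EVERY dimension and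
for EVERY degree `[K′ : K]`: from the OUTPUT of [CoP1] Prop. 8.1 upstairs — a regular local blow-up `S′` of the
normal local model `R₁′` along `f` with `(S₀)_f = S_f` and `√(fS′) = √(𝔪_{R₁′}S′) = (x₀⋯x_{r-1})`, read together
with the (46)-choice of downstairs monomials `fᵢ = γᵢ ∏ xⱼ^{aᵢⱼ}`, `det(aᵢⱼ) ≠ 0` — to the QUASI-FINITE regular
model `S″ = k[t′, F, H]_𝔪` whose closed point is cut out by `K`-functions `F₀…F_{r-1}, H_r…H_{d-1}`
([CoP1] (46)–(52), HAL pp. 27–28).  MECHANISM (page hits from the materialised text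
`paper:doi-10-1016-j-jalgebra-2008-03-032`, PDF page = printed page + 1): (46) printed p. 27 "`fᵢ = γᵢ ∏ⱼ xⱼ^{aᵢⱼ}`
where `γᵢ` is a unit in `S′` … the matrix `A := (aᵢⱼ)` is nonsingular … `B` the adjoint matrix of `A` …
`Fᵢ := ∏ⱼ fⱼ^{bⱼᵢ} ∈ S′ ∩ K`" (adjugate monomials: tree `MonomialAdjugate.exists_unit_mul_pow_mem_subfield`); (47)–(48)
p. 28 "`gⱼ = gⱼ′ ∏ᵢ xᵢ^{cᵢⱼ} ∈ P₁′ ⊂ R₁′` with `gⱼ′` not divisible by `xᵢ`" (tree form `gⱼ′ = unit·xⱼ`, from Prop. 8.1 (1)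
by `exists_mem_eq_unit_mul_prod_pow`); (44)/(50) pp. 27–28 "`R₁′ ⊂ R₁ʰ` … In particular, `R₁` lies dense in `R₁′` for
the `𝔪_{R₁′}`-adic topology. Let `C := max cᵢⱼ` and let `hⱼ ∈ R₁` be such that `hⱼ ≡ gⱼ mod 𝔪_{R₁′}^{C+1}`" (tree
`exists_finset_dense_locAtCentre`); (51) p. 28 "`Hⱼ := hⱼ^{det A} / ∏ᵢ Fᵢ^{cᵢⱼ} ∈ S′ ∩ K`" (tree
`StrictTransformApproximation`); (52) p. 28 "`√(({Fᵢ}, {Hⱼ})S′) = 𝔪_{S′}` … by (52) and Zariski's Main Theorem `R` lies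
below `S′`" (this file, `exists_radical_eq_maximalIdeal_of_dense_fin`, the `Fin d` re-assembly of the tree's `Fin 3`
version `exists_radical_eq_maximalIdeal_of_dense`).  No norms or conjugates occur in layer 3 (row 207's phrase
«norms/conjugates of g′₁» is superseded by these page hits, row 223c (q2)).

CONTENTS (all sorry-free, standard axioms, ZERO fact binders — every Literature input is a THEOREM).
PART A (TOOLS, 0 banked by name): `exists_radical_eq_maximalIdeal_of_dense_fin` ((46)–(52) in dimension `d`:
VERBATIM port `Fin 3 ↦ Fin d` of `Literature.…DecompositionLayerStrictTransforms.exists_radical_eq_maximalIdeal_of_dense`),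
`exists_mul_mem_span_of_mem_span` ((52) cleared of denominators).
PART B: the E-frame ENGINE `exists_quasiFinite_of_monomialBlowup` (hypothesis-free; Galois closure ≤ decomposition
field by `closure_le_decompositionField`, density constants by `exists_finset_dense_locAtCentre`, the normal model
by `exists_normal_model`, its integral closure in `K′` by `exists_adjoin_eq_integralClosure_extension`, the head,
(47), (46)–(52), re-modelling `k[t] := k[t′, F, H]` with the same local ring, `Frac k[t₁ ∪ t₁′] = K′`); THE CELL
`MonomialBlowupAbove k O`; THE LAW `quasiFiniteLUAbove_of_monomialBlowupAbove : MonomialBlowupAbove k O →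
QuasiFiniteLUAbove k O` (TYPE exactly cell → the LANDED quasi-finite cell of `DecompositionDescentLU7` :50); the
composite `relLU_of_monomialBlowupAbove := relLU_of_quasiFiniteLUAbove ∘ _` BY NAME;
`decompositionFieldLUAbove_of_monomialBlowupAbove`; `not_monomialBlowupAbove_of_not_decompositionFieldLUAbove`.
PART C: the decided piece `NonKHToricArchLUKeyHenselDescentQuotTInertTwoMBCell` (`_holds`), the located residual
`R31 = NonKHToricArchLUKeyHenselDescentQuotTInertTwoMB e c n` (R30's binders ∧ `¬ MonomialBlowupAbove k O`), THE CUT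
`nonKHToricArchLUKeyHenselDescentQuotTInertTwo_iff_mb : R30 ↔ R31` (exact, hypothesis-free; and `…_of_mb` WITHOUT
case split — R31's extra binder is implied by R30's `¬ DecompositionFieldLUAbove`), the re-locations `R29/R28/R25/
R23/NonKHToricArchLU ↔ R31`, `…MB_of_root`, ROOT BY NAME `closes_mb` (binders = `closes_tame2`'s with `R30 ↦ R31`:
`hCP, hCJS, hAsc, hN : ∀ d ≥ 4, R31 3 3 d, h₃`), `root_iff_mb_sigma`.

COSTUME DIFF (row 223c (i)), clause by clause.  (α) against the hypothesis `hHead` of the tree THEOREM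
`Literature.…exists_localUniformization_of_head'` (DecompositionLayerStrictParameters; base `S` complete regular
local with `E | S` algebraic, `d = 3`): the cell's clause is that binder list VERBATIM with `S ↦ k` (a field: no
completeness, no algebraicity of `K̄ | k`), `M ↦ K`, `Fin 3 ↦ Fin d` (`d` existentially quantified) — normal model
`t₁`, presentation `t₁′` of the integral closure, `∃ t′ ⊇`, regular, `d, r, hr, x`, non-vanishing, span = `𝔪`,
(a), (b), (c).  (β) against the body of `QuasiFiniteLUAbove` (:50–): SHARED = the frame only (`O_E` above `O`,
residues algebraic, Hensel root `η` with `K`-rational residue, `K′ ≤ K⟮η⟯`) and «a model of `K′` inside `O_E`,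
regular at the centre, containing the given one» (here: containing the integral closure of a NORMAL model; there:
containing `R`); ABSENT from the cell = EVERYTHING ELSE of QF's last block — no `K`-functions `F` cutting out the
closed point, no (52)-saturation `∃ n b, v(b) = 0 ∧ b·yⁿ ∈ F·k[t]`, no approximants `hⱼ`, no `Hⱼ`, no
`K′ ≤ Frac k[t]` clause (the law PROVES `Frac k[t₁ ∪ t₁′] = K′`), no quantification over arbitrary models `R` (the
law enlarges `R[c]` to a normal model); PRESENT in the cell and absent from QF = the blow-up output (a), (c) with the
exceptional parameters `x₀…x_{r-1}` and the downstairs monomials (b).  What the law PRODUCES is exactly QF's last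
block.

ONE PAPER INSTANCE (row 223c (iii); [CoP1] §§8–9 with `d = 3`, written out).  `k ⊇ 𝔽_p`, `p ≠ 2`; `ξ, ζ ∈ x·k[[x]]`
algebraically independent over `k(x)`; `K := k(x, y, z) ↪ k((x))` by `y ↦ x + x²ξ`, `z ↦ x + x³ζ`, `O := K ∩ k[[x]]`:
rank 1, rational rank 1, residue field `k`, `trdeg 3` — a NON-Abhyankar place (`1 + 0 < 3`).  Layer: `η := √(1+x)
∈ k[[x]]` (Hensel root of `T² − (1+x)` over `O`, residue `1 ∈ k`, `v(2η) = 0` as `p ≠ 2`), `K′ := K(η) ≤ K⟮η⟯`,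
`[K′ : K] = 2`; both roots `±η` lie in `k((x))`, so `O` SPLITS in `K′` (`K′` inside the decomposition field) and
`O_E ∩ K′` is the prime singled out by the embedding.  Normal model `R₁ = k[x, y, z]` (`t₁ = {x, y, z}`); its integral
closure in `K′` is the polynomial ring `k[x, y, z, η] = k[η, y, z]` (`t₁′ = {η}`); `R₁′ = k[η, y, z]_{(η−1, y, z)}` is
regular with parameters `u := η − 1, y, z`, and `x = u(u+2)`.  Blow-up of the centre `𝔪_{R₁′} = (u, y, z)` in the
`u`-chart, localised at the centre of `O_E`: `S′ = k[u, y/u, z/u]_𝔪`, `t′ = {u, x₁, x₂}` with `x₁ := y/u − 2 =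
u(1 + (u+2)²ξ)`, `x₂ := z/u − 2` (positive values), `d = 3`, `r = 1`, `x₀ = u`; (c) `f = x = (u+2)·u ∈ R₁′` with
`w = u + 2 ∈ S′×` (residue `2 ≠ 0`), `e = (1)`, and `t′ ⊆ R₁′[1/x]` (`1/u = (u+2)/x`); (a) `𝔪_{R₁′}S′ = (u, y, z)S′ =
uS′` (`y = u(x₁+2)`, `z = u(x₂+2)`); (b) `f₀ = x ∈ K`, `γ₀ = u + 2`, `A = (1)`, `det A = 1`.  The law then runs:
(46) `F₀ = x` (`B = adj A = (1)`, `det A = 1`); (47)–(48) `g₁ = x₁·u = y − 2u`, `g₂ = x₂·u = z − 2u ∈ R₁′`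
(`gⱼ′ = xⱼ`, `c₁ⱼ = 1`); (50) `C = 1`, `h₁ := y − x`, `h₂ := z − x ∈ R₁` with `hⱼ − gⱼ = −u² ∈ 𝔪²_{R₁′}`; (51)
`h₁ = u·(x₁ − u)`, `H₁ := h₁ / F₀ = (y − x)/x = (x₁ − u)/(u + 2)`, `H₂ := (z − x)/x ∈ S′ ∩ K` (`Hⱼ S′ = (xⱼ − u)S′`,
a regular parameter transversal to the exceptional divisor); (52) `(x, H₁, H₂)S′ = (u, x₁ − u, x₂ − u)S′ = 𝔪_{S′}`.  Downstairs,
`k[x, (y−x)/x, (z−x)/x]_𝔪 ⊇ R₁` is regular and dominated by `O`: relative LU of `R₁` along `O`.  (At `trdeg 3` this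
example sits inside the floor `CossartPiltant2019LU3`; it is recorded to show that the cell is inhabited and that
its clauses mean what [CoP1] means — not as progress on the root.)

HONEST SCOPE.  (1) The law is hypothesis-free and consumes the cell in every dimension; the CELL is an INPUT: producing
a monomial blow-up upstairs from a local uniformization of `(K′, O_E ∩ K′)` is [CoP1] Prop. 8.1 ⇐ Prop. 4.1 (embedded
monomialization of an ideal in a regular `d`-fold), in print for `d = 3` (HAL pp. 21–22; inside the floor), OPEN —
Hironaka-strength principalization in characteristic `p` — for `d ≥ 4`: IDEA-NEEDED, not claimed, not typed as a
fact.  (2) `¬ MonomialBlowupAbove` is implied by R30's `¬ DecompositionFieldLUAbove`: the cut `R30 ↔ R31` re-locates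
the difficulty three layers up (the decomposition-descent door now asks only for a monomial blow-up upstairs), it
does not shrink the class of places; R31's docstring lists which `O` remain.  (3) «MB ⇏ QF cheaply» is not
mechanically probeable once the law is in scope (row 207 (v)); QF ⇏ MB, RelLU ⇏ MB, DecWitness ⇏ MB, DecField ⇏ MB
and the deletion cells (a)/(b)/(c) ⇏ QF, ⇏ RelLU are must-fails of `bc/Probe.lean`.

Sources: CossartPiltant2008 (Prop. 8.1, Prop. 9.3 and its proof (44)–(52), HAL pp. 21–22, 26–28); Abhyankar1959
(Thm. 1.47: `𝔪^{ν+1}`-approximation); ZariskiSamuelII (Ch. VIII §§10–11); Raynaud1970 (Ch. VII, étaleness of `S″ → S′`);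
EGA IV (18.12).  Problem side, sorry-free, hypothesis-free; heavy theorems carry `set_option maxHeartbeats … in`
BEFORE their docstrings — keep them.
-/

noncomputable section

open IsLocalRing Polynomial IntermediateField Literature.AlgebraicGeometry.Resolution
open Summit.ResolutionOfSingularities.ResolutionOfSingularities.Theorems.DecompositionDescentLU
open scoped Pointwise

namespace Summit.ResolutionOfSingularities.ResolutionOfSingularities.Theorems.MonomialBlowupLU

universe u


/-! ## PART A — [CossartPiltant2008, (46)–(52)] re-assembled in ARBITRARY DIMENSION `d` (the tree's
`Literature.AlgebraicGeometry.Resolution.exists_radical_eq_maximalIdeal_of_dense` is its `d = 3` instance; the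
bricks `exists_unit_mul_pow_mem_subfield` (46), `exists_mem_sub_mem_span_pow_of_dense` (48)+(50),
`exists_strictTransform_of_sub_mem` (51), `pow_div_prod_pow_eq` (49), `radical_eq_of_isUnit_mul_pow_mem` (52) are
dimension-free and reused BY NAME) and the denominator-clearing form of (52) used by the quasi-finite cell -/

section PortFin

variable {E : Type u} [Field E]

/-- The inverse of a unit of a subring of a field, read in the field, is the field inverse. [folklore] -/
theorem coe_units_inv_eq_inv' (S' : Subring E) (U : S'ˣ) :
    (((U⁻¹ : S'ˣ) : S') : E) = (((U : S'ˣ) : S') : E)⁻¹ := by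
  have h : ((U : S') : E) * (((U⁻¹ : S'ˣ) : S') : E) = 1 := by
    rw [← Subring.coe_mul, Units.mul_inv, Subring.coe_one]
  exact eq_inv_of_mul_eq_one_right h

set_option maxHeartbeats 800000 in
/-- **[CossartPiltant2008, Prop. 9.3, (46)–(52)] assembled in dimension `d`.** Let `S′` be a local subring of a
field `E` whose maximal ideal is generated by `x₀, …, x_{d-1}` (all non-zero), `K` a subfield, `R₁ ⊆ K` a subring,
`R₁′ ⊆ S′` a local subring in which `R₁` is `𝔪_{R₁′}`-adically dense, and `0 < r ≤ d` such that: (a)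
`𝔪_{R₁′} S′ ⊆ (x₀ ⋯ x_{r-1}) S′` ([CoP1] Prop. 8.1 (2)); (b) there are `fᵢ ∈ K` (`i < r`) with
`fᵢ = γᵢ ∏_{j<r} xⱼ^{aᵢⱼ}`, `γᵢ` units of `S′`, `det(aᵢⱼ) ≠ 0` ([CoP1] (46)); (c) for `r ≤ j < d` there is
`gⱼ ∈ R₁′` with `gⱼ = uⱼ xⱼ ∏_{i<r} xᵢ^{cⱼᵢ}`, `uⱼ` a unit ([CoP1] (47)–(48)).  THEN there are `D > 0`,
`Fᵢ ∈ K ∩ 𝔪_{S′}` (`i < r`) and `Hⱼ ∈ K ∩ 𝔪_{S′}` (`r ≤ j < d`) with `√((Fᵢ, Hⱼ) S′) = 𝔪_{S′}` — the printed proof,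
word for word the tree's `exists_radical_eq_maximalIdeal_of_dense` with `Fin 3 ↦ Fin d` (the number of `Hⱼ`'s,
`d − r`, is ARBITRARY). (Sources: CossartPiltant2008, proof of Prop. 9.3, (46)–(52) (HAL pp. 27–28);
CossartPiltant2019, proof of Prop. 4.6, (5101)–(5102).) -/
theorem exists_radical_eq_maximalIdeal_of_dense_fin
    (S' R₁' : Subring E) [IsLocalRing S'] [IsLocalRing R₁'] (h₁ : R₁' ≤ S')
    (R₁ : Subring E) (K : Subfield E) (hR₁K : R₁ ≤ K.toSubring)
    (hdense : ∀ (n : ℕ) (y : E), y ∈ R₁' →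
      ∃ a ∈ R₁, ∃ z : R₁', z ∈ maximalIdeal R₁' ^ n ∧ (z : E) = y - a)
    {d r : ℕ} (hr : r ≤ d) (hr0 : 0 < r) (x : Fin d → S') (hx0 : ∀ j, ((x j : S') : E) ≠ 0)
    (hxm : Ideal.span (Set.range x) = maximalIdeal S')
    (ha : ∀ z : R₁', z ∈ maximalIdeal R₁' →
      Subring.inclusion h₁ z ∈ Ideal.span {∏ i : Fin r, x (Fin.castLE hr i)})
    (γ : Fin r → S'ˣ) (A : Matrix (Fin r) (Fin r) ℕ)
    (hdet : (A.map (fun n : ℕ => (n : ℤ))).det ≠ 0)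
    (f : Fin r → E) (hfK : ∀ i, f i ∈ K)
    (hf : ∀ i, f i = ((γ i : S') : E) * ∏ j, ((x (Fin.castLE hr j) : S') : E) ^ A i j)
    (hg : ∀ j : Fin d, r ≤ (j : ℕ) → ∃ (g : E) (w : S'ˣ) (c : Fin r → ℕ), g ∈ R₁' ∧
      g = ((w : S') : E) * ((x j : S') : E) * ∏ i, ((x (Fin.castLE hr i) : S') : E) ^ c i) :
    ∃ (D : ℕ) (_ : 0 < D) (F : Fin r → S') (H : {j : Fin d // r ≤ (j : ℕ)} → S'),
      (∀ i, (F i : E) ∈ K) ∧ (∀ j, (H j : E) ∈ K) ∧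
      (∀ i, F i ∈ maximalIdeal S') ∧ (∀ j, H j ∈ maximalIdeal S') ∧
      (Ideal.span (Set.range F ∪ Set.range H)).radical = maximalIdeal S' := by
  classical
  -- the exceptional parameters `x₀, …, x_{r-1}`
  set xr : Fin r → S' := fun i => x (Fin.castLE hr i) with hxr_def
  have hxr0 : ∀ j, ((xr j : S') : E) ≠ 0 := fun j => hx0 _
  have hxmem : ∀ j, x j ∈ maximalIdeal S' := fun j => by
    rw [← hxm]; exact Ideal.subset_span ⟨j, rfl⟩
  have hspan_le : Ideal.span (Set.range xr) ≤ maximalIdeal S' :=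
    Ideal.span_le.mpr (by rintro _ ⟨i, rfl⟩; exact hxmem _)
  have hprod_mem : (∏ i, xr i) ∈ Ideal.span (Set.range xr) := by
    have hi₀ : (⟨0, hr0⟩ : Fin r) ∈ Finset.univ := Finset.mem_univ _
    rw [← Finset.prod_erase_mul _ _ hi₀]
    exact Ideal.mul_mem_left _ _ (Ideal.subset_span ⟨_, rfl⟩)
  have hprod_span_le : Ideal.span {∏ i, xr i} ≤ Ideal.span (Set.range xr) :=
    (Ideal.span_singleton_le_iff_mem _).mpr hprod_mem
  /- (46): `Fᵢ = uᵢ xᵢ^D ∈ K` -/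
  have hf' : ∀ i, f i = ((γ i : S') : E) *
      ∏ j, ((xr j : S') : E) ^ (A.map (fun n : ℕ => (n : ℤ))) i j := by
    intro i
    rw [hf i]
    congr 1
    refine Finset.prod_congr rfl fun j _ => ?_
    rw [Matrix.map_apply, zpow_natCast]
  obtain ⟨D, hD, F, u, hFK, hF⟩ :=
    exists_unit_mul_pow_mem_subfield S' K xr hxr0 γ _ hdet f hfK hf'
  let F' : Fin r → S' := fun i => (u i : S') * xr i ^ D
  have hF'E : ∀ i, ((F' i : S') : E) = F i := by
    intro i
    rw [hF i]
    simp only [F', Subring.coe_mul, Subring.coe_pow]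
  have hF'm : ∀ i, F' i ∈ maximalIdeal S' := fun i =>
    Ideal.mul_mem_left _ _ (Ideal.pow_mem_of_mem _ (hxmem _) D hD)
  /- (47)–(48): the elements `gⱼ ∈ R₁′` and their approximations `hⱼ ∈ R₁` -/
  have hg' : ∀ j : {j : Fin d // r ≤ (j : ℕ)}, ∃ (g : E) (w : S'ˣ) (c : Fin r → ℕ), g ∈ R₁' ∧
      g = ((w : S') : E) * ((x j.1 : S') : E) * ∏ i, ((xr i : S') : E) ^ c i :=
    fun j => hg j.1 j.2
  choose g w c hgR hgE using hg'
  have hgS : ∀ j, (⟨g j, h₁ (hgR j)⟩ : S') = ((w j : S') * x j.1) * ∏ i, xr i ^ c j i := by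
    intro j
    apply Subtype.ext
    push_cast
    exact hgE j
  -- (48)+(50)+(51): `hⱼ ∈ R₁`, `hⱼ = h′ⱼ ∏ xᵢ^{cⱼᵢ}`, `h′ⱼ ≡ wⱼ xⱼ mod (x₀⋯x_{r-1})`
  have hstrict : ∀ j, ∃ hj h'j : S', (hj : E) ∈ R₁ ∧ hj = h'j * ∏ i, xr i ^ c j i ∧
      h'j - (w j : S') * x j.1 ∈ Ideal.span {∏ i, xr i} := by
    intro j
    set C : ℕ := Finset.univ.sup (c j) with hC
    have hcC : ∀ i, c j i ≤ C := fun i => Finset.le_sup (f := c j) (Finset.mem_univ i)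
    obtain ⟨hj, hjR₁, hjg⟩ := exists_mem_sub_mem_span_pow_of_dense S' R₁' h₁ R₁ hdense
      (∏ i, xr i) ha (C + 1) ⟨g j, h₁ (hgR j)⟩ (hgR j)
    obtain ⟨h'j, hhj, hh'j⟩ := exists_strictTransform_of_sub_mem xr (c j) C hcC
      (⟨g j, h₁ (hgR j)⟩ : S') ((w j : S') * x j.1) hj (hgS j) hjg
    exact ⟨hj, h'j, hjR₁, hhj, hh'j⟩
  choose hh h' hhR₁ hhh' hh'g using hstrict
  have hh'm : ∀ j, h' j ∈ maximalIdeal S' := by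
    intro j
    have : h' j = (h' j - (w j : S') * x j.1) + (w j : S') * x j.1 := by ring
    rw [this]
    exact Ideal.add_mem _ (hspan_le (hprod_span_le (hh'g j))) (Ideal.mul_mem_left _ _ (hxmem _))
  /- (49): `Hⱼ := hⱼ^D / ∏ Fᵢ^{cⱼᵢ} = unit · (h′ⱼ)^D ∈ K` -/
  let U : {j : Fin d // r ≤ (j : ℕ)} → S'ˣ := fun j => ∏ i, u i ^ c j i
  let H' : {j : Fin d // r ≤ (j : ℕ)} → S' := fun j => ((U j)⁻¹ : S'ˣ) * h' j ^ D
  have hUE : ∀ j, (((U j : S'ˣ) : S') : E) = ∏ i, (((u i : S'ˣ) : S') : E) ^ c j i := by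
    intro j
    simp only [U, Units.coe_prod, Units.val_pow_eq_pow_val]
    push_cast
    rfl
  have hH'E : ∀ j, ((H' j : S') : E) = ((hh j : S') : E) ^ D / ∏ i, F i ^ c j i := by
    intro j
    have hu0 : ∀ i, (((u i : S'ˣ) : S') : E) ≠ 0 := by
      intro i h0
      have : ((u i : S'ˣ) : S') = 0 := Subtype.ext h0
      exact (u i).ne_zero this
    have hhjE : ((hh j : S') : E) = ((h' j : S') : E) * ∏ i, ((xr i : S') : E) ^ c j i := by
      have := congrArg (fun t : S' => (t : E)) (hhh' j)
      push_cast at this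
      exact this
    rw [pow_div_prod_pow_eq D (fun i => ((xr i : S') : E)) (fun i => (((u i : S'ˣ) : S') : E))
      F (c j) hxr0 hu0 hF _ _ hhjE]
    simp only [H', Subring.coe_mul, Subring.coe_pow, coe_units_inv_eq_inv', hUE]
  have hH'K : ∀ j, ((H' j : S') : E) ∈ K := by
    intro j
    rw [hH'E j]
    exact div_mem (pow_mem (hR₁K (hhR₁ j)) D)
      (prod_mem fun i _ => pow_mem (hFK i) _)
  have hH'm : ∀ j, H' j ∈ maximalIdeal S' := fun j =>
    Ideal.mul_mem_left _ _ (Ideal.pow_mem_of_mem _ (hh'm j) D hD)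
  /- (52): the radical -/
  let g' : {j : Fin d // r ≤ (j : ℕ)} → S' := fun j => (w j : S') * x j.1
  have h𝔪 : Ideal.span (Set.range xr ∪ Set.range g') = maximalIdeal S' := by
    refine le_antisymm (Ideal.span_le.mpr ?_) ?_
    · rintro _ (⟨i, rfl⟩ | ⟨j, rfl⟩)
      · exact hxmem _
      · exact Ideal.mul_mem_left _ _ (hxmem _)
    · rw [← hxm]
      refine Ideal.span_le.mpr ?_
      rintro _ ⟨k, rfl⟩
      by_cases hk : (k : ℕ) < r
      · have hk' : Fin.castLE hr ⟨k, hk⟩ = k := Fin.ext rfl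
        have : x k = xr ⟨k, hk⟩ := by simp only [hxr_def, hk']
        rw [SetLike.mem_coe, this]
        exact Ideal.subset_span (Or.inl ⟨_, rfl⟩)
      · have hrk : r ≤ (k : ℕ) := not_lt.mp hk
        have : x k = ((w ⟨k, hrk⟩)⁻¹ : S'ˣ) * g' ⟨k, hrk⟩ := by
          simp only [g', ← mul_assoc, Units.inv_mul, one_mul]
        rw [SetLike.mem_coe, this]
        exact Ideal.mul_mem_left _ _ (Ideal.subset_span (Or.inr ⟨_, rfl⟩))
  have hI : Ideal.span (Set.range F' ∪ Set.range H') ≤ maximalIdeal S' := by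
    refine Ideal.span_le.mpr ?_
    rintro _ (⟨i, rfl⟩ | ⟨j, rfl⟩)
    · exact hF'm i
    · exact hH'm j
  have hrad := radical_eq_of_isUnit_mul_pow_mem xr g' (Ideal.span (Set.range F' ∪ Set.range H'))
    (maximalIdeal S') h𝔪 hI D
    (fun i => ⟨(u i : S'), Units.isUnit _, Ideal.subset_span (Or.inl ⟨i, rfl⟩)⟩)
    (fun j => ⟨(((U j)⁻¹ : S'ˣ) : S'), h' j, Units.isUnit _,
      Ideal.subset_span (Or.inr ⟨j, rfl⟩), hprod_span_le (hh'g j)⟩)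
  exact ⟨D, hD, F', H', fun i => (hF'E i) ▸ hFK i, hH'K, hF'm, hH'm, hrad⟩

/-- **(52), denominator-wise on a model.** Let `B ⊆ S′ ⊆ E` with every element of `S′` a fraction `a/c`,
`a, c ∈ B`, `v(c) = 0` (e.g. `S′ = B′_𝔪` for a model `B′ ⊆ B`), and `F` a finite set.  An element of the ideal
`F·S′` becomes, after multiplication by some `b ∈ B` of value `0`, an element of the `B`-module `F·B` — clearing
the value-`0` denominators of a finite `S′`-linear combination (the form in which the quasi-finite cell
`DecompositionDescentLU.QuasiFiniteLUAbove` reads [CossartPiltant2008, (52)] `√((Fᵢ,Hⱼ)S′) = 𝔪_{S′}`). [folklore] -/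
theorem exists_mul_mem_span_of_mem_span {S : Type u} [CommRing S] [Algebra S E]
    (B : Subalgebra S E) (OE : ValuationSubring E) (S' : Subring E)
    (hfrac : ∀ s ∈ S', ∃ a ∈ B, ∃ c ∈ B, OE.valuation c = 1 ∧ s = a / c)
    (F : Finset E) {w : S'} (hw : w ∈ Ideal.span {w : S' | (w : E) ∈ F}) :
    ∃ b ∈ B, OE.valuation b = 1 ∧ b * (w : E) ∈ Submodule.span B (F : Set E) := by
  classical
  refine Submodule.span_induction (p := fun (w : S') _ =>
    ∃ b ∈ B, OE.valuation b = 1 ∧ b * (w : E) ∈ Submodule.span B (F : Set E)) ?_ ?_ ?_ ?_ hw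
  · intro w hw
    exact ⟨1, B.one_mem, by simp, by rw [one_mul]; exact Submodule.subset_span hw⟩
  · exact ⟨1, B.one_mem, by simp, by simp⟩
  · rintro w₁ w₂ - - ⟨b₁, hb₁, hv₁, h₁⟩ ⟨b₂, hb₂, hv₂, h₂⟩
    refine ⟨b₁ * b₂, B.mul_mem hb₁ hb₂, by rw [map_mul, hv₁, hv₂, one_mul], ?_⟩
    have : b₁ * b₂ * ((w₁ + w₂ : S') : E) = (⟨b₂, hb₂⟩ : B) • (b₁ * (w₁ : E)) +
        (⟨b₁, hb₁⟩ : B) • (b₂ * (w₂ : E)) := by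
      rw [Subring.coe_add, Subalgebra.smul_def, Subalgebra.smul_def, smul_eq_mul, smul_eq_mul]
      push_cast; ring
    rw [this]
    exact Submodule.add_mem _ (Submodule.smul_mem _ _ h₁) (Submodule.smul_mem _ _ h₂)
  · rintro s w - ⟨b, hb, hvb, h⟩
    obtain ⟨a, ha, c, hc, hvc, hs⟩ := hfrac (s : E) s.2
    have hc0 : c ≠ 0 := ne_zero_of_valuation_eq_one hvc
    refine ⟨c * b, B.mul_mem hc hb, by rw [map_mul, hvc, hvb, one_mul], ?_⟩
    have : c * b * ((s • w : S') : E) = (⟨a, ha⟩ : B) • (b * (w : E)) := by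
      rw [smul_eq_mul, Subring.coe_mul, Subalgebra.smul_def, smul_eq_mul, hs]
      field_simp
    rw [this]
    exact Submodule.smul_mem _ _ h

end PortFin

end Summit.ResolutionOfSingularities.ResolutionOfSingularities.Theorems.MonomialBlowupLU

end
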